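import Literature.MathematicalPhysics.QuantumLattice.WilsonDiracAP
import Summits.QuantumFields.QCD.Theorems.QuarksAsStableActionCriticalLineDiamagnetismStubQuarkChessboardOfSchwarzAux2
import Summits.QuantumFields.QCD.Theorems.QuarksAsStableActionCriticalLineDiamagnetismStubHadamardUpper
import Summits.QuantumFields.QCD.Theorems.QuarksAsStableActionCriticalLineDiamagnetismStubFreeDetFormula
import Summits.QuantumFields.QCD.Theorems.QuarksAsStableActionCriticalLineDiamagnetismStubFreeSymbolSum
import Summits.QuantumFields.QCD.Theorems.QuarksAsStableActionCriticalLineDiamagnetismStubCellIncidence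
import Summits.QuantumFields.QCD.Theorems.QuarksAsStableActionCriticalLineDiamagnetismStubQuarkChessboardOfSchwarz
import Summits.QuantumFields.QCD.Theorems.QuarksAsStableActionCriticalLineDiamagnetismStubCellGainOfGauged
import Summits.QuantumFields.QCD.Theorems.QuarksAsStableActionCriticalLineDiamagnetismStubBlochFactorisation
import Summits.QuantumFields.QCD.Theorems.QuarksAsStableActionCriticalLineDiamagnetismStubFreeBlochBlocks
import Summits.QuantumFields.QCD.Theorems.QuarksAsStableActionCriticalLineDiamagnetismStubCellDetFactorisation
import Summits.QuantumFields.QCD.Theorems.QuarksAsStableActionCriticalLineDiamagnetismStubDetPerturbIR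
import Summits.QuantumFields.QCD.Theorems.QuarksAsStableActionCriticalLineDiamagnetismStubLogDetSecondOrder
import Summits.QuantumFields.QCD.Theorems.QuarksAsStableActionCriticalLineDiamagnetismStubDeltaBounds
import Summits.QuantumFields.QCD.Theorems.QuarksAsStableActionCriticalLineDiamagnetismStubBlochLatticeSum
import Summits.QuantumFields.QCD.Theorems.QuarksAsStableActionCriticalLineDiamagnetismStubTilingCellData
import Summits.QuantumFields.QCD.Theorems.QuarksAsStableActionCriticalLineDiamagnetismStubCellGainTilingGlue
import Summits.QuantumFields.QCD.Theorems.QuarksAsStableActionCriticalLineDiamagnetismStubBlockEstimate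
import Summits.QuantumFields.QCD.Theorems.QuarksAsStableActionCriticalLineDiamagnetismStubCellGainCore
import Summits.QuantumFields.QCD.Theorems.QuarksAsStableActionCriticalLineDiamagnetismStubCellRegauge
import Summits.QuantumFields.QCD.Theorems.QuarksAsStableActionCriticalLineDiamagnetismStubBackgroundSchwarz
import Summits.QuantumFields.QCD.Theorems.QuarksAsStableActionCriticalLineDiamagnetismStubTadpole
import Summits.QuantumFields.QCD.Theorems.QuarksAsStableActionCriticalLineDiamagnetismStubUnitaryCellIneq
import Summits.QuantumFields.QCD.Theorems.QuarksAsStableActionCriticalLineDiamagnetismStubBilinearBounds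
import Summits.QuantumFields.QCD.Theorems.QuarksAsStableActionCriticalLineDiamagnetismStubOneLoopMarginOfAux
import Summits.QuantumFields.QCD.Theorems.QuarksAsStableActionCriticalLineDiamagnetismStubTilingCombinatorics
import Summits.QuantumFields.QCD.Theorems.QuarksAsStableActionCriticalLineDiamagnetismStubTwistCounting
import Summits.QuantumFields.QCD.Theorems.QuarksAsStableActionCriticalLineDiamagnetismStubMassLipschitz
import Summits.QuantumFields.QCD.Theorems.QuarksAsStableActionCriticalLineDiamagnetismStubWardKernel
import Summits.QuantumFields.QCD.Theorems.QuarksAsStableActionCriticalLineDiamagnetismStubGaugeCoercive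
import Summits.QuantumFields.QCD.Theorems.QuarksAsStableActionCriticalLineDiamagnetismHessianMarginOfStubsAux
import Summits.QuantumFields.QCD.Theorems.QuarksAsStableActionCriticalLineDiamagnetismStubCornerCounting
import Summits.QuantumFields.QCD.Theorems.QuarksAsStableActionCriticalLineDiamagnetismHessianMarginOfStubsAux2

/-!
# The even half of the crux — bookkeeping definitions (crux stmt-QuantumFields-9734, line `Sketch`, lead c3)

Shorthands of the skeleton's composition (`Lines/Sketch.lean`, section `Helpers`), moved to the tree so that the even half
of the crux can land as a theorem (`…EvenHalf.lean`): the all-axes antiperiodic Wilson determinant `dAP3` of a `U(3)` field,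
the reflection tiling `tile3` of a cell, the plaquette defect `dfc3`, cell incidence `inCell`, the crux's determinant and defect
`cruxDet`/`cruxDfc` (literally the `let`s of the crux statement) with their identifications (`cruxDet_eq`, `cruxDfc_eq`, …),
`goodCell`, the per-cell exponent `cellExp` and its sum bound `sum_cellExp_le`, and the elementary `exponent_mono`,
`exponent_bookkeeping`. Verbatim from the skeleton (rc 0 there since v3); no facts, no axioms.
-/

noncomputable section

open scoped BigOperators Classical Matrix ComplexConjugate
open Finset
open Literature.MathematicalPhysics.QuantumLattice Literature.MathematicalPhysics.QuantumFieldTheory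
  Literature.Probability.LatticeModels

namespace Summit.QuantumFields.QCD.Cruxes.CriticalLineDiamagnetism.ChessboardCellGain

/-! ## Sorry-free helpers of the composition -/

section Helpers

variable {L : ℕ}


/-- (composition shorthand) the all-axes antiperiodic Wilson determinant of a `U(3)` field, literally the `dAP` of
`QuarkChessboard` / of the stubs. -/
def dAP3 [NeZero L] (V : GaugeConfig 4 L (Matrix.unitaryGroup (Fin 3) ℂ)) (m : ℝ) : ℂ :=
  (wilsonDirac (unitaryFundamentalRep (Fin 3) ℂ) (fun e => if (e.1 e.2).val + 1 = L then -V e else V e) m 1).det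

/-- (composition shorthand) the period-2 reflection tiling, literally the `tile` of `QuarkChessboard`. -/
def tile3 [NeZero L] (c : Site 4 L) (V : GaugeConfig 4 L (Matrix.unitaryGroup (Fin 3) ℂ)) : GaugeConfig 4 L (Matrix.unitaryGroup (Fin 3) ℂ) := fun e =>
  if (e.1 e.2 - c e.2).val % 2 = 0 then V (fun ν => c ν + (((e.1 ν - c ν).val % 2 : ℕ) : ZMod L), e.2)
  else (V (fun ν => c ν + (((Site.shift e.1 e.2 ν - c ν).val % 2 : ℕ) : ZMod L), e.2))⁻¹

/-- (composition shorthand) the plaquette deficit of a `U(3)` field. -/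
def dfc3 (V : GaugeConfig 4 L (Matrix.unitaryGroup (Fin 3) ℂ)) (p : Plaquette 4 L) : ℝ :=
  3 - (unitaryFundamentalRep (Fin 3) ℂ (plaquetteHolonomy V p.1 p.2.1.1 p.2.1.2)).trace.re

/-- (composition shorthand) `p` is a plaquette of the closed unit cell with lowest corner `c`. -/
abbrev inCell (c : Site 4 L) (p : Plaquette 4 L) : Prop :=
  p.1 p.2.1.1 = c p.2.1.1 ∧ p.1 p.2.1.2 = c p.2.1.2 ∧
    ∀ ν, ν ≠ p.2.1.1 → ν ≠ p.2.1.2 → (p.1 ν = c ν ∨ p.1 ν = c ν + 1)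

/-- (composition shorthand) the crux's `apDet`. -/
def cruxDet [NeZero L] (U : GaugeConfig 4 L (Matrix.specialUnitaryGroup (Fin 3) ℂ)) (m : ℝ) : ℂ :=
  fermionDet (wilsonDirac (unitaryFundamentalRep (Fin 3) ℂ)
    (fun e => if e.1 e.2 = -1 then -(⟨(U e).1, Matrix.specialUnitaryGroup_le_unitaryGroup (U e).2⟩ : (Matrix.unitaryGroup (Fin 3) ℂ))
      else ⟨(U e).1, Matrix.specialUnitaryGroup_le_unitaryGroup (U e).2⟩) m 1)

/-- (composition shorthand) the crux's `dfc`. -/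
def cruxDfc (U : GaugeConfig 4 L (Matrix.specialUnitaryGroup (Fin 3) ℂ)) (p : Plaquette 4 L) : ℝ :=
  3 - (fundamentalRep (Fin 3) (plaquetteHolonomy U p.1 p.2.1.1 p.2.1.2)).trace.re

/-- The crux's inlined antiperiodic lift is the `val + 1 = L` seam twist of the plain `U(3)` lift. -/
theorem cruxLift_eq [NeZero L] (U : GaugeConfig 4 L (Matrix.specialUnitaryGroup (Fin 3) ℂ)) :
    (fun e : Edge 4 L => if e.1 e.2 = -1 then -(⟨(U e).1, Matrix.specialUnitaryGroup_le_unitaryGroup (U e).2⟩ : (Matrix.unitaryGroup (Fin 3) ℂ))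
      else ⟨(U e).1, Matrix.specialUnitaryGroup_le_unitaryGroup (U e).2⟩) =
    fun e : Edge 4 L => if (e.1 e.2).val + 1 = L then -(unitaryLift U e) else unitaryLift U e := by
  funext e
  simp only [val_add_one_eq_iff']
  rfl

/-- The crux determinant is the `U(3)`-side determinant of the plain lift. -/
theorem cruxDet_eq [NeZero L] (U : GaugeConfig 4 L (Matrix.specialUnitaryGroup (Fin 3) ℂ)) (m : ℝ) : cruxDet U m = dAP3 (unitaryLift U) m := by
  unfold cruxDet dAP3
  rw [cruxLift_eq U]

/-- The plain lift of the trivial field is trivial. -/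
theorem unitaryLift_one : unitaryLift (1 : GaugeConfig 4 L (Matrix.specialUnitaryGroup (Fin 3) ℂ)) = (1 : GaugeConfig 4 L (Matrix.unitaryGroup (Fin 3) ℂ)) := by
  funext e
  rfl

/-- The free crux determinant is the free `U(3)`-side determinant. -/
theorem cruxDet_one [NeZero L] (m : ℝ) : cruxDet (1 : GaugeConfig 4 L (Matrix.specialUnitaryGroup (Fin 3) ℂ)) m = dAP3 (1 : GaugeConfig 4 L (Matrix.unitaryGroup (Fin 3) ℂ)) m := by
  rw [cruxDet_eq, unitaryLift_one]

/-- Plaquette holonomies of the plain lift are the lifted holonomies. -/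
theorem plaquetteHolonomy_unitaryLift (U : GaugeConfig 4 L (Matrix.specialUnitaryGroup (Fin 3) ℂ)) (x : Site 4 L) (i j : Fin 4) :
    plaquetteHolonomy (unitaryLift U) x i j = suInclusion (N := 3) (plaquetteHolonomy U x i j) := by
  simp only [plaquetteHolonomy, unitaryLift_apply, map_mul, map_inv]

/-- The `U(3)`-side deficit of the lift is the crux's `SU(3)`-side deficit. -/
theorem cruxDfc_eq (U : GaugeConfig 4 L (Matrix.specialUnitaryGroup (Fin 3) ℂ)) (p : Plaquette 4 L) : cruxDfc U p = dfc3 (unitaryLift U) p := by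
  unfold cruxDfc dfc3
  rw [plaquetteHolonomy_unitaryLift]
  rfl

/-- Deficits of `U(3)` fields lie in `[0, 6]`. -/
theorem dfc3_nonneg (V : GaugeConfig 4 L (Matrix.unitaryGroup (Fin 3) ℂ)) (p : Plaquette 4 L) : 0 ≤ dfc3 V p := by
  have h := plaquetteDeficit_nonneg (unitaryFundamentalRep (Fin 3) ℂ) unitaryFundamentalRep_mem_unitaryGroup V p
  simp only [plaquetteDeficit, Nat.cast_ofNat] at h
  exact h

/-- `dfc3_le_six` (skeleton helper, verbatim). -/
theorem dfc3_le_six (V : GaugeConfig 4 L (Matrix.unitaryGroup (Fin 3) ℂ)) (p : Plaquette 4 L) : dfc3 V p ≤ 6 := by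
  have h := plaquetteDeficit_le (unitaryFundamentalRep (Fin 3) ℂ) unitaryFundamentalRep_mem_unitaryGroup V p
  simp only [plaquetteDeficit, Nat.cast_ofNat] at h
  unfold dfc3
  linarith

/-- `card (Site 4 L) = L⁴`. -/
theorem card_site [NeZero L] : Fintype.card (Site 4 L) = L ^ 4 := by
  simp [ZMod.card]

/-- The fundamental representation of `SU(3)` is unitary-valued. -/
theorem fundamentalRep_mem_unitary (g : (Matrix.specialUnitaryGroup (Fin 3) ℂ)) : fundamentalRep (Fin 3) g ∈ Matrix.unitaryGroup (Fin 3) ℂ :=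
  Matrix.specialUnitaryGroup_le_unitaryGroup g.2

/-- Crux-side deficits are non-negative. -/
theorem cruxDfc_nonneg (U : GaugeConfig 4 L (Matrix.specialUnitaryGroup (Fin 3) ℂ)) (p : Plaquette 4 L) : 0 ≤ cruxDfc U p := by
  have h := plaquetteDeficit_nonneg (fundamentalRep (Fin 3)) fundamentalRep_mem_unitary U p
  simp only [plaquetteDeficit, Nat.cast_ofNat] at h
  exact h

/-- Monotonicity of the crux exponent in its constants: shrinking `δ` and `c₁`, growing `K` and `C ≥ 0`. -/
theorem exponent_mono {ι : Type*} (s : Finset ι) (d : ι → ℝ) (hd : ∀ i, 0 ≤ d i)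
    {δ δ' c c' K K' C C' : ℝ} (hδ : δ' ≤ δ) (hc : c' ≤ c) (hc' : 0 ≤ c') (hK : K ≤ K') (hC : C ≤ C') (hC0 : 0 ≤ C') :
    K - c * (∑ i ∈ s.filter (fun i => d i < δ), d i) + C * ((s.filter (fun i => δ ≤ d i)).card : ℝ) ≤
      K' - c' * (∑ i ∈ s.filter (fun i => d i < δ'), d i) + C' * ((s.filter (fun i => δ' ≤ d i)).card : ℝ) := by
  have hS : (∑ i ∈ s.filter (fun i => d i < δ'), d i) ≤ ∑ i ∈ s.filter (fun i => d i < δ), d i := by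
    apply Finset.sum_le_sum_of_subset_of_nonneg
    · intro i hi
      simp only [Finset.mem_filter] at hi ⊢
      exact ⟨hi.1, lt_of_lt_of_le hi.2 hδ⟩
    · intro i _ _
      exact hd i
  have hS0 : 0 ≤ ∑ i ∈ s.filter (fun i => d i < δ'), d i := Finset.sum_nonneg fun i _ => hd i
  have hN : ((s.filter (fun i => δ ≤ d i)).card : ℝ) ≤ ((s.filter (fun i => δ' ≤ d i)).card : ℝ) := by
    exact_mod_cast Finset.card_le_card (fun i hi => by
      simp only [Finset.mem_filter] at hi ⊢
      exact ⟨hi.1, le_trans hδ hi.2⟩)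
  have hN0 : (0 : ℝ) ≤ ((s.filter (fun i => δ ≤ d i)).card : ℝ) := by positivity
  have h1 : c' * (∑ i ∈ s.filter (fun i => d i < δ'), d i) ≤ c * ∑ i ∈ s.filter (fun i => d i < δ), d i :=
    mul_le_mul hc hS hS0 (le_trans hc' hc)
  have h2 : C * ((s.filter (fun i => δ ≤ d i)).card : ℝ) ≤ C' * ((s.filter (fun i => δ' ≤ d i)).card : ℝ) :=
    le_trans (mul_le_mul_of_nonneg_right hC hN0) (mul_le_mul_of_nonneg_left hN hC0)
  linarith

/-- The arithmetic of the cell exponents (all quantities real): from `#good·K₀ ≤ L⁴|K₀|`, `S ≤ P`,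
`T ≤ 144·#bad`, `#bad ≤ 4·N`. -/
theorem exponent_bookkeeping {L4 K₀ cg Sg P T nB Nb nG H : ℝ} (hL4 : 0 ≤ L4) (hcg : 0 ≤ cg) (hH : 0 ≤ H)
    (hK : nG * K₀ ≤ L4 * |K₀|) (hS : Sg ≤ P) (hT : T ≤ 144 * nB) (hB : nB ≤ 4 * Nb) :
    nG * K₀ - cg * (L4 / 4) * (4 * P - T) + nB * (H * L4) ≤ L4 * (|K₀| - cg * Sg + (4 * H + 144 * cg) * Nb) := by
  have a1 : 0 ≤ cg * L4 * (P - Sg) := mul_nonneg (mul_nonneg hcg hL4) (by linarith)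
  have a2 : 0 ≤ cg * L4 * (144 * nB - T) := mul_nonneg (mul_nonneg hcg hL4) (by linarith)
  have a3 : 0 ≤ cg * L4 * (4 * Nb - nB) := mul_nonneg (mul_nonneg hcg hL4) (by linarith)
  have a4 : 0 ≤ H * L4 * (4 * Nb - nB) := mul_nonneg (mul_nonneg hH hL4) (by linarith)
  nlinarith [a1, a2, a3, a4, hK]

/-- (composition shorthand) all plaquettes of the closed cell `c` are `δ₀`-good. -/
def goodCell (δ₀ : ℝ) (V : GaugeConfig 4 L (Matrix.unitaryGroup (Fin 3) ℂ)) (c : Site 4 L) : Prop := ∀ p, inCell c p → dfc3 V p < δ₀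

/-- (composition shorthand) the exponent attached to the cell `c`: the gain for a good cell, the Hadamard price
for a bad one. -/
def cellExp [NeZero L] (K₀ cg H δ₀ : ℝ) (V : GaugeConfig 4 L (Matrix.unitaryGroup (Fin 3) ℂ)) (c : Site 4 L) : ℝ :=
  if goodCell δ₀ V c then K₀ - cg * ((L : ℝ) ^ 4 / 4) * ∑ p ∈ univ.filter (fun p => inCell c p), dfc3 V p
  else H * (L : ℝ) ^ 4

/-- **Cell bookkeeping.** With each plaquette in exactly 4 closed cells and at most 24 plaquettes per cell, the cell
exponents sum to at most `L⁴ (|K₀| − cg·S_good + (4H + 144 cg)·N_bad)`. -/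
theorem sum_cellExp_le [NeZero L] (K₀ cg H δ₀ : ℝ) (hcg : 0 ≤ cg) (hH : 0 ≤ H) (V : GaugeConfig 4 L (Matrix.unitaryGroup (Fin 3) ℂ))
    (hCellCard : ∀ c : Site 4 L, (univ.filter (fun p => inCell c p)).card ≤ 24)
    (hFour : ∀ p : Plaquette 4 L, (univ.filter (fun c => inCell c p)).card = 4) :
    ∑ c : Site 4 L, cellExp K₀ cg H δ₀ V c ≤
      (L : ℝ) ^ 4 * (|K₀| - cg * (∑ p ∈ univ.filter (fun p => dfc3 V p < δ₀), dfc3 V p) +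
        (4 * H + 144 * cg) * ((univ.filter (fun p => δ₀ ≤ dfc3 V p)).card : ℝ)) := by
  have hd0 : ∀ p, 0 ≤ dfc3 V p := fun p => dfc3_nonneg V p
  have hd6 : ∀ p, dfc3 V p ≤ 6 := fun p => dfc3_le_six V p
  set Sg : ℝ := ∑ p ∈ univ.filter (fun p => dfc3 V p < δ₀), dfc3 V p with hSg
  set Nb : ℕ := (univ.filter (fun p => δ₀ ≤ dfc3 V p)).card with hNb
  set G : Finset (Site 4 L) := univ.filter (fun c => goodCell δ₀ V c) with hG
  set B : Finset (Site 4 L) := univ.filter (fun c => ¬ goodCell δ₀ V c) with hB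
  -- #bad cells ≤ 4 N_bad
  have hBcard : (B.card : ℝ) ≤ 4 * Nb := by
    have hsub : B ⊆ (univ.filter (fun p => δ₀ ≤ dfc3 V p)).biUnion (fun p => univ.filter (fun c => inCell c p)) := by
      intro c hc
      have hc' : ¬ goodCell δ₀ V c := (Finset.mem_filter.1 hc).2
      simp only [goodCell, not_forall, not_lt, exists_prop] at hc'
      obtain ⟨p, hp, hdp⟩ := hc'
      simp only [Finset.mem_biUnion, Finset.mem_filter, Finset.mem_univ, true_and]
      exact ⟨p, hdp, hp⟩
    have h := le_trans (Finset.card_le_card hsub) Finset.card_biUnion_le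
    have h' : ∑ p ∈ univ.filter (fun p => δ₀ ≤ dfc3 V p), (univ.filter (fun c => inCell c p)).card = 4 * Nb := by
      rw [Finset.sum_congr rfl (fun p _ => hFour p), Finset.sum_const, smul_eq_mul, hNb, mul_comm]
    rw [h'] at h
    exact_mod_cast h
  -- Σ_c Σ_{p ∈ cell c} d = 4 Σ_p d
  have hswap : ∑ c : Site 4 L, ∑ p ∈ univ.filter (fun p => inCell c p), dfc3 V p = 4 * ∑ p : Plaquette 4 L, dfc3 V p := by
    have : ∀ c : Site 4 L, ∑ p ∈ univ.filter (fun p => inCell c p), dfc3 V p =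
        ∑ p : Plaquette 4 L, if inCell c p then dfc3 V p else 0 := fun c => by
      rw [Finset.sum_filter]
    simp_rw [this]
    rw [Finset.sum_comm, Finset.mul_sum]
    refine Finset.sum_congr rfl fun p _ => ?_
    rw [← Finset.sum_filter, Finset.sum_const, nsmul_eq_mul, hFour p]
    push_cast; ring
  have hSall : Sg ≤ ∑ p : Plaquette 4 L, dfc3 V p :=
    Finset.sum_le_sum_of_subset_of_nonneg (Finset.filter_subset _ _) (fun p _ _ => hd0 p)
  -- Σ over bad cells of cell sums ≤ 144 |B|
  have hBsum : ∑ c ∈ B, ∑ p ∈ univ.filter (fun p => inCell c p), dfc3 V p ≤ 144 * B.card := by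
    have : ∀ c ∈ B, ∑ p ∈ univ.filter (fun p => inCell c p), dfc3 V p ≤ 144 := fun c _ => by
      calc ∑ p ∈ univ.filter (fun p => inCell c p), dfc3 V p ≤ ∑ _p ∈ univ.filter (fun p => inCell c p), (6 : ℝ) :=
            Finset.sum_le_sum fun p _ => hd6 p
        _ = 6 * (univ.filter (fun p => inCell c p)).card := by rw [Finset.sum_const, nsmul_eq_mul, mul_comm]
        _ ≤ 6 * 24 := by gcongr; exact_mod_cast hCellCard c
        _ = 144 := by norm_num
    calc ∑ c ∈ B, ∑ p ∈ univ.filter (fun p => inCell c p), dfc3 V p ≤ ∑ _c ∈ B, (144 : ℝ) := Finset.sum_le_sum this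
      _ = 144 * B.card := by rw [Finset.sum_const, nsmul_eq_mul, mul_comm]
  -- split the sum over good and bad cells
  have hsplit : ∑ c : Site 4 L, cellExp K₀ cg H δ₀ V c =
      (∑ c ∈ G, (K₀ - cg * ((L : ℝ) ^ 4 / 4) * ∑ p ∈ univ.filter (fun p => inCell c p), dfc3 V p)) +
        ∑ c ∈ B, H * (L : ℝ) ^ 4 := by
    rw [← Finset.sum_filter_add_sum_filter_not univ (fun c => goodCell δ₀ V c)]
    congr 1
    · refine Finset.sum_congr rfl fun c hc => ?_
      have hc' : goodCell δ₀ V c := (Finset.mem_filter.1 hc).2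
      simp only [cellExp, if_pos hc']
    · refine Finset.sum_congr rfl fun c hc => ?_
      have hc' : ¬ goodCell δ₀ V c := (Finset.mem_filter.1 hc).2
      simp only [cellExp, if_neg hc']
  have hgoodsum : ∑ c ∈ G, ∑ p ∈ univ.filter (fun p => inCell c p), dfc3 V p =
      4 * (∑ p : Plaquette 4 L, dfc3 V p) - ∑ c ∈ B, ∑ p ∈ univ.filter (fun p => inCell c p), dfc3 V p := by
    rw [← hswap, ← Finset.sum_filter_add_sum_filter_not univ (fun c => goodCell δ₀ V c)]
    ring
  have hK : (G.card : ℝ) * K₀ ≤ (L : ℝ) ^ 4 * |K₀| := by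
    calc (G.card : ℝ) * K₀ ≤ G.card * |K₀| := mul_le_mul_of_nonneg_left (le_abs_self _) (by positivity)
      _ ≤ (L : ℝ) ^ 4 * |K₀| := by
          gcongr
          have := Finset.card_filter_le (univ : Finset (Site 4 L)) (fun c => goodCell δ₀ V c)
          rw [Finset.card_univ, card_site] at this
          exact_mod_cast this
  have hL0 : (0 : ℝ) ≤ (L : ℝ) ^ 4 := by positivity
  rw [hsplit, Finset.sum_sub_distrib, ← Finset.mul_sum, hgoodsum, Finset.sum_const, nsmul_eq_mul,
    Finset.sum_const, nsmul_eq_mul]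
  exact exponent_bookkeeping hL0 hcg hH hK hSall hBsum hBcard

end Helpers

/-- **Registered helper `stub_evenHalfCardSite`** (= `card_site`): the `4`-torus of side `L` has `L⁴` sites. -/
theorem stub_evenHalfCardSite : ∀ (L : ℕ) [NeZero L], Fintype.card (Site 4 L) = L ^ 4 :=
  fun _ _ => card_site

end Summit.QuantumFields.QCD.Cruxes.CriticalLineDiamagnetism.ChessboardCellGain

end
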